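/-
HarnessLib.Audit.Status.Attr — the FOUR status attributes (ARCHITECTURE.md §1.2, human ruling 2026-09-01:
programme state lives in the Lean tree; open / proved / refuted / closed-mod-print and thesis membership are
DERIVED from the types of landed theorems by `HarnessLib.Audit.Status.Classify`, never written by hand).

Imports `Lean` + the two existing Lean-only tag modules, so any Summits/Literature file can
`import HarnessLib.Audit.Status.Attr` without pulling anything new into its import closure
(`HarnessLib.Attr` = what `import HarnessLib` gives every file; `HarnessLib.Audit.Tags` = what `import HarnessLib.Audit` gives).
Lives under `HarnessLib/Audit/` so it stays OUT of the generated `HarnessLib.lean` aggregator (gate rule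
`_root_module_ok`): landing it rebuilds nothing downstream. Module path ≠ namespace on purpose: the API namespace is
`HarnessLib.Status` (Phase 2 may move the files to `HarnessLib/Status/` without renaming a single declaration).

NO NEW ENVIRONMENT EXTENSION: all four attributes record `(decl, attr, args)` entries into the EXISTING
`HarnessLib.tagExt` of `HarnessLib.Attr` (so `#harness_tags X` and the gate's HARNESSTAG probe see them unchanged).
-/
import Lean
import HarnessLib.Attr
import HarnessLib.Audit.Tags

/-!
# Status attributes

* `@[crux (bottleneck := idea|work)? (experiment := "…")? (source := "seat/date")?]` on `def C : Prop := …` —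
  an obligation node of a summit. Every field is OPTIONAL and is TIER J (a judgement, stamped by `source`);
  a missing `bottleneck` is a linter warning (`linter.cruxBottleneck`), never an error. Fields in any order.
* `@[printed (cite := "BibKey, Thm x.y")?]` on a Literature `def F : Prop := …` — a published statement typed as
  a NAMED FACT (assumable BY NAME by a closer; once `theorem F_holds : F` lands it drops out of every mod-print
  list). No tier field (human 2026-09-01). It is the canonical spelling of, and is read together with, today's
  `@[cite …]`, `@[claim …]`, `@[folklore]`, `@[cite_pending]` (ALIAS TABLE below).
* `@[evidence_for C]` on a `theorem` whose statement mentions `C` — partial progress bearing on `C`.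
* `@[barrier C]` on a `theorem` whose statement mentions `C` — a proved obstruction on the way to `C`.

## Elaboration-time checks (hard errors)
* `@[crux]` / `@[printed]`: the declaration is a `def`/`abbrev` whose type (after parameters) is `Prop`; applied in
  the DECLARING module (no `attribute [crux] Foo` retro-tagging of imported declarations); `global` only;
  crux fields ∈ {bottleneck, experiment, source}, `bottleneck ∈ {idea, work}`, no duplicates; printed field = `cite`;
  not both `@[crux]` and printed-family on one declaration.
* `@[evidence_for C]` / `@[barrier C]`: `C` resolves (unknown-constant error, with hover info), `C` is a Prop-valued
  `def`, the tagged declaration is a `theorem` of this module, and `C`'s constant name OCCURS in the theorem's type.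
  (Whether `C` is a registered crux is NOT checked here — a barrier may land before the crux is tagged; the status
  report lists edges whose target is not a node.)

## Alias table (read side; `printedFamily`, `cruxInfo?`, `isConjectureMarked`)
| written in the tree today                         | read as            | args recorded / read                       |
|---------------------------------------------------|--------------------|--------------------------------------------|
| `@[printed (cite := "Key, loc")]` (new, canonical) | printed            | `#[Key, loc]` (split at the first comma)   |
| `@[cite "Key" "loc"?]`                             | printed            | `#[Key, loc?]`                             |
| `@[claim "Key" "status"]`                          | printed (claim)    | `#[Key, status]`                           |
| `@[folklore]`                                      | printed (no key)   | `#[]`                                      |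
| `@[cite_pending]`                                  | printed (pending)  | `#[]`                                      |
| docstring `[cite: Key, loc]` `[claim: …]` `[folklore]` `[cite pending]` on a `Literature` Prop def | printed (Classify option `docTags`, default on — this is the form 99 % of the tree uses) | text inside the brackets |
| `@[conjecture]` (HarnessLib.Audit.Tags) or docstring `[conjecture…]` / `[open problem…]` / `[status: open…]` | NOT printed (an open conjecture is an obligation, never an assumable fact) | — |
A declaration that is a node (statement or crux) is never printed, whatever its tags say.
-/

open Lean Elab

namespace HarnessLib.Status

/-! ## Linter option (tier-J nudge, never an error) -/

/-- Warn when `@[crux]` carries no `(bottleneck := idea|work)`. The gate should list `linter.cruxBottleneck` in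
`lint.warnings_allow` (warnings are errors at the gate otherwise). -/
register_option linter.cruxBottleneck : Bool := {
  defValue := true
  descr := "warn when @[crux] is applied without (bottleneck := idea|work)"
}

/-! ## Vocabulary -/

/-- Bottleneck of an open crux: an IDEA is missing (a wall), or only WORK (hours) is. Tier J. -/
inductive Bottleneck | idea | work
  deriving Inhabited, Repr, BEq, DecidableEq

def Bottleneck.toString : Bottleneck → String
  | .idea => "idea" | .work => "work"
instance : ToString Bottleneck := ⟨Bottleneck.toString⟩
def Bottleneck.ofString? : String → Option Bottleneck
  | "idea" => some .idea | "work" => some .work | _ => none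

/-- Attribute names under which the four status attributes record into `HarnessLib.tagExt`. -/
def cruxAttr : Name := `crux
def printedAttr : Name := `printed
def evidenceAttr : Name := `evidence_for
def barrierAttr : Name := `barrier

/-- ALIAS TABLE (attribute form): tag names in `HarnessLib.tagExt` that make a Prop-valued def a printed fact. -/
def printedFamily : List Name := [`printed, `cite, `claim, `folklore, `cite_pending]

/-- The tier-J content of an `@[crux]` tag. -/
structure CruxInfo where
  decl       : Name
  bottleneck : Option Bottleneck := none
  experiment : Option String := none
  source     : Option String := none
  deriving Inhabited, Repr

/-- `key=value` encoding of the optional crux fields inside `TagEntry.args` (layout of `tagExt` unchanged). -/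
def CruxInfo.toArgs (c : CruxInfo) : Array String :=
  (match c.bottleneck with | some b => #[s!"bottleneck={b}"] | none => #[]) ++
  (match c.experiment with | some e => #[s!"experiment={e}"] | none => #[]) ++
  (match c.source with | some s => #[s!"source={s}"] | none => #[])

/-- Split `"key=value"` at the FIRST `=`. -/
def splitKV (s : String) : Option (String × String) :=
  match s.splitOn "=" with
  | k :: rest@(_ :: _) => some (k, "=".intercalate rest)
  | _ => none

/-- Decode the `args` of a `crux` tag entry. Unknown keys are ignored (forward compatible). -/
def CruxInfo.ofArgs (decl : Name) (args : Array String) : CruxInfo :=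
  args.foldl (init := { decl }) fun c a =>
    match splitKV a with
    | some ("bottleneck", v) => { c with bottleneck := Bottleneck.ofString? v }
    | some ("experiment", v) => { c with experiment := some v }
    | some ("source", v) => { c with source := some v }
    | _ => c

/-- All tag entries of `HarnessLib.tagExt` visible from `env` (imported, then local). -/
def allTagEntries (env : Environment) : Array HarnessLib.TagEntry := HarnessLib.tagExt.getState env

/-- The `@[crux]` info recorded for `decl`, if any (first entry wins; there is at most one by construction). -/
def cruxInfo? (env : Environment) (decl : Name) : Option CruxInfo :=
  (HarnessLib.tagsOf env decl).findSome? fun t =>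
    if t.attr == cruxAttr then some (CruxInfo.ofArgs decl t.args) else none

/-- First printed-family tag of `decl` (attribute form only): `(attrName, args)`. -/
def printedTag? (env : Environment) (decl : Name) : Option (Name × Array String) :=
  (HarnessLib.tagsOf env decl).findSome? fun t =>
    if printedFamily.contains t.attr then some (t.attr, t.args) else none

def hasCruxTag (env : Environment) (n : Name) : Bool := (cruxInfo? env n).isSome
def hasPrintedTag (env : Environment) (n : Name) : Bool := (printedTag? env n).isSome

/-- `@[evidence_for C]` / `@[barrier C]` edges recorded in `env`: `(theorem, target)`. -/
def edgeEntries (env : Environment) (attr : Name) : Array (Name × Name) :=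
  (allTagEntries env).filterMap fun t =>
    if t.attr == attr then t.args[0]?.map fun s => (t.decl, s.toName) else none

/-! ## Shared checks (pure) -/

/-- `n` is a `def`/`abbrev` whose type, after its parameters, is `Prop` (`def C : Prop`, `def P (K : Type) : Prop`). -/
def isPropDef (env : Environment) (n : Name) : Bool :=
  match env.find? n with
  | some (.defnInfo d) => d.type.getForallBody.isProp
  | _ => false

/-- `n` is a `def`/`abbrev` whose type is literally `Prop` — a CLOSED proposition (no parameters). -/
def isClosedPropDef (env : Environment) (n : Name) : Bool :=
  match env.find? n with
  | some (.defnInfo d) => d.type.isProp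
  | _ => false

/-- Number of `∀`-binders of the TYPE of `n` (0 for a closed Prop def). -/
def declArity (env : Environment) (n : Name) : Nat :=
  match env.find? n with
  | some ci => ci.type.getForallBinderNames.length
  | none => 0

/-- Module that declares `n` (`none` = the module being elaborated). O(1). -/
def declModule? (env : Environment) (n : Name) : Option Name :=
  match env.getModuleIdxFor? n with
  | some i => (env.header.modules[i.toNat]?).map (·.module)
  | none => none

/-- A statement module: `Summits.<S>.Statement` / `Summits.<S>.<Sub>.Statement` (any `<root>.….Statement` with
`<root>` among the scanned roots — decided by the caller; here only the suffix). -/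
def isStatementModuleName (m : Name) : Bool :=
  match m with
  | .str _ "Statement" => true
  | _ => false

/-- `s` contains `pat` (plain substring test; `String.splitOn` is total and allocation-cheap for short docs). -/
def containsSub (s pat : String) : Bool :=
  if pat.isEmpty then true else (s.splitOn pat).length > 1

/-- Text between the first `open_` and the next `]`, trimmed (docstring tag argument), if `open_` occurs. -/
def bracketArg? (doc open_ : String) : Option String :=
  match doc.splitOn open_ with
  | _ :: rest :: _ => some ((rest.splitOn "]").headD "").trimAscii.toString
  | _ => none

/-- Raw (Markdown) docstring of `n` — pure lookup in core's `docStringExt` (no builtin / inherited docs). -/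
def docOf? (env : Environment) (n : Name) : Option String :=
  Lean.docStringExt.find? (level := .server) env n

/-- Docstring-form printed tag (gate grammar `TAG_DOC_RE` / `CITE_PENDING_DOC_RE` of harness/gate/cpu_stages.py):
`[cite: Key, loc]` · `[cite]` · `[claim: Key, status: …]` · `[folklore]` · `[cite pending]`/`[cite_pending]`/`[cite-pending]`.
Returns `(kind, argText)`. -/
def docPrintedTag? (doc : String) : Option (String × String) :=
  if containsSub doc "[cite:" then some ("cite", (bracketArg? doc "[cite:").getD "")
  else if containsSub doc "[claim:" then some ("claim", (bracketArg? doc "[claim:").getD "")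
  else if containsSub doc "[folklore" then some ("folklore", "")
  else if containsSub doc "[cite]" then some ("cite", "")
  else
    let l := doc.toLower
    if containsSub l "[cite pending]" || containsSub l "[cite_pending]" || containsSub l "[cite-pending]" then some ("cite_pending", "")
    else none

/-- OPEN-CONJECTURE markers that VETO printed-hood: `@[conjecture]` (HarnessLib.Audit.Tags) or the docstring tokens of
the gate's `CONJ_DOC_RE` (`[conjecture…]`, `[open problem…]`, `[status: open…]`, case-insensitive). -/
def isConjectureMarked (env : Environment) (n : Name) : Bool :=
  (HarnessLib.Audit.tagsOfDecl env n).any (·.attr == `conjecture) ||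
  (match docOf? env n with
   | some d =>
     let l := d.toLower
     containsSub l "[conjecture" || containsSub l "[open problem" || containsSub l "[open-problem" ||
       containsSub l "[status: open" || containsSub l "[status:open"
   | none => false)

/-! ## Attribute-time checks -/

private def requireGlobal (attr : String) (kind : AttributeKind) : AttrM Unit :=
  unless kind == AttributeKind.global do
    throwError "@[{attr}] is global only (no `local` / `scoped`)"

private def requireDeclaredHere (attr : String) (decl : Name) : AttrM Unit := do
  if let some m := declModule? (← getEnv) decl then
    throwError "@[{attr}] {decl}: apply the attribute in the module that DECLARES {decl} (it is imported from {m}); retro-tagging imported declarations is not allowed"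

private def requirePropDef (attr : String) (decl : Name) : AttrM Unit := do
  unless isPropDef (← getEnv) decl do
    throwError "@[{attr}] goes on a Prop-valued definition `def {decl} … : Prop := …` (not a theorem, structure, type abbreviation or axiom)"

/-- Record one `(decl, attr, args)` entry into the EXISTING `HarnessLib.tagExt`. -/
private def record (decl attr : Name) (args : Array String) : AttrM Unit :=
  modifyEnv fun env => HarnessLib.tagExt.addEntry env { decl, attr, args }

/-! ## Syntax

`statusField` = `(name := value)` with `value` an identifier or a string literal; which names/values are legal is
checked by the handler (order-free fields, precise error messages). `idea`/`work`/`bottleneck`/… are ordinary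
identifiers, not keywords. -/

/-- One `(field := value)` argument of `@[crux …]` / `@[printed …]`. -/
syntax statusField := "(" ident " := " (ident <|> str) ")"
/-- `@[crux (bottleneck := idea|work)? (experiment := "…")? (source := "…")?]` — obligation node (`def C : Prop`). -/
syntax (name := crux) "crux" (ppSpace statusField)* : attr
/-- `@[printed (cite := "BibKey, Thm x.y")?]` — published statement typed as a named fact (`def F : Prop`). -/
syntax (name := printed) "printed" (ppSpace statusField)* : attr
/-- `@[evidence_for C]` — theorem bearing on crux `C` without settling it. -/
syntax (name := evidence_for) "evidence_for " ident : attr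
/-- `@[barrier C]` — proved obstruction on the way to crux `C`. -/
syntax (name := barrier) "barrier " ident : attr

/-- Decode the `(field := value)*` list of a `crux`/`printed` attribute: `(fieldName, fieldSyntax, value)` where
value is `.inl identString` or `.inr stringLiteral`. -/
private def fieldsOf (stx : Syntax) : AttrM (Array (String × Syntax × (String ⊕ String))) := do
  let mut out := #[]
  for f in stx[1].getArgs do
    -- statusField := "(" ident " := " (ident <|> str) ")"
    let key := f[1].getId.toString
    let v := f[3]
    let val : String ⊕ String :=
      match v.isStrLit? with
      | some s => .inr s
      | none => .inl v.getId.toString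
    if out.any (·.1 == key) then
      throwErrorAt f "duplicate field `({key} := …)`"
    out := out.push (key, f, val)
  return out

/-- Every atom occurring in `stx` (used by the `#status` command family). -/
partial def atomsOf (stx : Syntax) : Array String :=
  match stx with
  | .atom _ v => #[v]
  | .node _ _ args => args.foldl (fun acc a => acc ++ atomsOf a) #[]
  | _ => #[]

/-! ## Handlers -/

initialize registerBuiltinAttribute {
  name  := `crux
  descr := "obligation node of a summit: @[crux (bottleneck := idea|work)? (experiment := \"…\")? (source := \"…\")?] def C : Prop := …"
  applicationTime := .afterTypeChecking
  add   := fun decl stx kind => do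
    requireGlobal "crux" kind
    requireDeclaredHere "crux" decl
    requirePropDef "crux" decl
    let env ← getEnv
    if hasPrintedTag env decl then
      throwError "@[crux] {decl}: already carries a printed-family tag (@[printed]/@[cite]/@[claim]/@[folklore]/@[cite_pending]) — a printed fact is not an obligation node; pick one"
    if hasCruxTag env decl then
      throwError "@[crux] {decl}: already registered (apply @[crux] once)"
    let mut info : CruxInfo := { decl }
    for (key, f, val) in ← fieldsOf stx do
      match key, val with
      | "bottleneck", .inl v =>
        match Bottleneck.ofString? v with
        | some b => info := { info with bottleneck := some b }
        | none => throwErrorAt f "@[crux]: bottleneck must be `idea` or `work` (got `{v}`)"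
      | "bottleneck", .inr _ => throwErrorAt f "@[crux]: write `(bottleneck := idea)` or `(bottleneck := work)` (an identifier, not a string)"
      | "experiment", .inr s => info := { info with experiment := some s }
      | "source", .inr s => info := { info with source := some s }
      | "experiment", .inl _ | "source", .inl _ => throwErrorAt f "@[crux]: `({key} := \"…\")` takes a string literal"
      | k, _ => throwErrorAt f "@[crux]: unknown field `{k}` (fields: bottleneck, experiment, source)"
    if info.bottleneck.isNone then
      Lean.Linter.logLintIf linter.cruxBottleneck stx
        m!"@[crux] {decl}: no `(bottleneck := idea|work)` — the status report will list this crux with bottleneck MISSING (tier-J judgement; add it with `(source := \"seat/date\")`)"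
    record decl cruxAttr info.toArgs
}

initialize registerBuiltinAttribute {
  name  := `printed
  descr := "published statement typed as a named fact: @[printed (cite := \"BibKey, Thm x.y\")] def F : Prop := …"
  applicationTime := .afterTypeChecking
  add   := fun decl stx kind => do
    requireGlobal "printed" kind
    requireDeclaredHere "printed" decl
    requirePropDef "printed" decl
    let env ← getEnv
    if hasCruxTag env decl then
      throwError "@[printed] {decl}: already @[crux] — an obligation node is not a printed fact; pick one"
    let mut cite : Option String := none
    for (key, f, val) in ← fieldsOf stx do
      match key, val with
      | "cite", .inr s =>
        if s.trimAscii.isEmpty then throwErrorAt f "@[printed]: empty `cite` (write `(cite := \"BibKey, Thm x.y\")`, or omit the field for folklore)"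
        cite := some s
      | "cite", .inl _ => throwErrorAt f "@[printed]: `(cite := \"BibKey, Thm x.y\")` takes a string literal"
      | k, _ => throwErrorAt f "@[printed]: unknown field `{k}` (the only field is `cite`; there is no tier — human ruling 2026-09-01)"
    -- args layout = that of @[cite "Key" "loc"]: #[key, locator] (locator may be absent)
    let args : Array String := match cite with
      | none => #[]
      | some s => match s.splitOn "," with
        | key :: rest@(_ :: _) => #[key.trimAscii.toString, (",".intercalate rest).trimAscii.toString]
        | _ => #[s.trimAscii.toString]
    record decl printedAttr args
}

/-- Shared handler of `@[evidence_for C]` / `@[barrier C]`: resolve `C`, check it is a Prop-valued def, check the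
tagged declaration is a theorem of this module whose TYPE mentions `C` by name, then record the edge. -/
private def addEdge (attr : Name) (decl : Name) (id : Syntax) (kind : AttributeKind) : AttrM Unit := do
  let a := attr.toString
  requireGlobal a kind
  requireDeclaredHere a decl
  -- (1) the target resolves to a constant (unknown-constant error names the identifier; hover info in the editor)
  let target ← realizeGlobalConstNoOverloadWithInfo id
  let env ← getEnv
  -- (2) … which is a Prop-valued def (cruxes / statements are `def C : Prop := …`)
  unless isPropDef env target do
    throwError "@[{a} {target}]: {target} is not a Prop-valued `def` (cruxes are `def C : Prop := …`)"
  -- (3) the tagged declaration is a theorem and its statement mentions the target BY NAME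
  let some ci := env.find? decl
    | throwError "@[{a}]: {decl} not found"
  unless ci matches .thmInfo _ do
    throwError "@[{a} {target}] goes on a `theorem` ({decl} is not one)"
  unless ci.type.getUsedConstants.contains target do
    throwError "@[{a} {target}]: `{target}` does not occur in the statement of {decl} — a theorem tagged @[{a}] must mention its crux BY NAME (e.g. `{target} → …`, `… → {target}` on a restricted class, `¬ Stronger ∧ (Stronger → {target})`)"
  record decl attr #[target.toString]

initialize registerBuiltinAttribute {
  name  := `evidence_for
  descr := "partial progress bearing on a crux: @[evidence_for C] theorem …"
  applicationTime := .afterTypeChecking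
  add   := fun decl stx kind => do
    match stx with
    | `(attr| evidence_for $id:ident) => addEdge evidenceAttr decl id kind
    | _ => throwError "malformed @[evidence_for]: expected @[evidence_for CruxName]"
}

initialize registerBuiltinAttribute {
  name  := `barrier
  descr := "proved obstruction on the way to a crux: @[barrier C] theorem …"
  applicationTime := .afterTypeChecking
  add   := fun decl stx kind => do
    match stx with
    | `(attr| barrier $id:ident) => addEdge barrierAttr decl id kind
    | _ => throwError "malformed @[barrier]: expected @[barrier CruxName]"
}

end HarnessLib.Status
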